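import Summits.Ventures.Crystal3D.Theorems.StickyWulffConstantPolycrystalWulffBoundBodyChange

/-!
# `PolycrystalWulffBound`: SHARP BODY CHANGE — changing the bodies of some grains costs at most the
# free energy of those grains for a GAP BODY

Route `StickyWulffConstant` of the venture `Summits/Ventures/Crystal3D`, crux `PolycrystalWulffBound`
(item `stmt-Ventures-19482`), second prover lane (poly-p2, gen 11).  Sharp form of
`freeEnergy_bodyChange_ge` (`…BodyChange`, constant `(R − r)·Y_f` from the in- and circum-radii): for pairwise
disjoint polyhedral grains `G_f` of finite volume, origin-symmetric compact convex bodies `K_f`, `K'_f`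
(equal off a set `T` of grains) and a GAP BODY `D` (compact, convex, symmetric, `0 ∈ D`) with

  `h_{K'_f}(ν) ≤ h_{K_f}(ν) + c · h_D(ν)`   for all `ν` and all `f ∈ T`,

the free energies satisfy `Fr(K') ≤ Fr(K) + c · Σ_{f ∈ T} Fr_D(f)`, where
`Fr_D(f) = per_D(G f) − Σ_{g ≠ f} ι_D(G f, G g)` is the `D`-energy of the FREE boundary of grain `f`
(`freeEnergy_bodyChange_le_add`).  With the twin pair `K = W(A)`, `K' = W(B) = R_m W(A)` and
`D = Dsc m`, `c = 1/√6` (`supportFn_le_twin_disc`, `…TwinSupportGap`) this is the sharp TWIN BODY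
CHANGE used by the hybrid single-axis rung: re-labelling a grain with the twin body costs at most
`(1/√6)·(sin∠(ν, m)-weighted free area)`, i.e. the thin-plate constant, and nothing on its walls.
Ingredients: `exists_exterior_crossSums` (free energy = half the cross sum with the exterior cells) and
the termwise comparison of cross sums (`crossSum_le_add_of_supportFn_le`).
WHAT THIS IS NOT: a rung; the crux is not claimed.
-/

noncomputable section

namespace Summit.Ventures.Crystal3D.Theorems

open MeasureTheory Set
open scoped RealInnerProductSpace ENNReal
open Summit.Ventures.Crystal3D.Cruxes.TextureLiminf.TexShadow

/-- **Cross sums under a support-function gap.**  If `h_{K'}(ν) ≤ h_K(ν) + c·h_D(ν)` for all `ν`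
then for any cell data and index sets `crossSum_{K'}(s,t) ≤ crossSum_K(s,t) + c·crossSum_D(s,t)`. -/
theorem crossSum_le_add_of_supportFn_le {K K' D : Set E3} {c : ℝ}
    (hgap : ∀ ν : E3, supportFn K' ν ≤ supportFn K ν + c * supportFn D ν)
    {k : ℕ} (H : Fin k → Finset (E3 × ℝ)) (ν : Fin k → Fin k → E3) (s t : Finset (Fin k)) :
    (∑ a ∈ s, ∑ b ∈ t,
        (if a < b then (supportFn K' (ν a b) + supportFn K' (-ν a b)) *
            facetArea (closure (polytope (H a)) ∩ closure (polytope (H b))) (ν a b)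
          else (supportFn K' (ν b a) + supportFn K' (-ν b a)) *
            facetArea (closure (polytope (H b)) ∩ closure (polytope (H a))) (ν b a))) ≤
      (∑ a ∈ s, ∑ b ∈ t,
        (if a < b then (supportFn K (ν a b) + supportFn K (-ν a b)) *
            facetArea (closure (polytope (H a)) ∩ closure (polytope (H b))) (ν a b)
          else (supportFn K (ν b a) + supportFn K (-ν b a)) *
            facetArea (closure (polytope (H b)) ∩ closure (polytope (H a))) (ν b a))) +
      c * ∑ a ∈ s, ∑ b ∈ t,
        (if a < b then (supportFn D (ν a b) + supportFn D (-ν a b)) *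
            facetArea (closure (polytope (H a)) ∩ closure (polytope (H b))) (ν a b)
          else (supportFn D (ν b a) + supportFn D (-ν b a)) *
            facetArea (closure (polytope (H b)) ∩ closure (polytope (H a))) (ν b a)) := by
  rw [Finset.mul_sum, ← Finset.sum_add_distrib]
  refine Finset.sum_le_sum fun a _ => ?_
  rw [Finset.mul_sum, ← Finset.sum_add_distrib]
  refine Finset.sum_le_sum fun b _ => ?_
  have hterm : ∀ (v : E3) (F : Set E3),
      (supportFn K' v + supportFn K' (-v)) * facetArea F v ≤
        (supportFn K v + supportFn K (-v)) * facetArea F v +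
          c * ((supportFn D v + supportFn D (-v)) * facetArea F v) := by
    intro v F
    have hF : 0 ≤ facetArea F v := ENNReal.toReal_nonneg
    have h1 := hgap v
    have h2 := hgap (-v)
    have : supportFn K' v + supportFn K' (-v) ≤
        (supportFn K v + supportFn K (-v)) + c * (supportFn D v + supportFn D (-v)) := by linarith
    calc (supportFn K' v + supportFn K' (-v)) * facetArea F v
        ≤ ((supportFn K v + supportFn K (-v)) + c * (supportFn D v + supportFn D (-v))) * facetArea F v :=
          mul_le_mul_of_nonneg_right this hF
      _ = _ := by ring
  split_ifs
  · exact hterm _ _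
  · exact hterm _ _

/-- **Sharp body change.**  For pairwise disjoint polyhedral grains of finite volume, origin-symmetric
compact convex bodies `K_f`, `K'_f` with `K'_f = K_f` off `T`, and a symmetric compact convex gap body
`D ∋ 0` with `h_{K'_f} ≤ h_{K_f} + c·h_D` on `T`:
`Fr(K') ≤ Fr(K) + c·Σ_{f ∈ T} Fr_D(f)`. -/
theorem freeEnergy_bodyChange_le_add {n : ℕ} (G : Fin n → Set E3)
    (hPoly : ∀ f, ∃ (k : ℕ) (H : Fin k → Finset (E3 × ℝ)), G f = ⋃ i, polytope (H i))
    (hvol : ∀ f, volume (G f) < ⊤) (hdisjG : ∀ f g, f ≠ g → Disjoint (G f) (G g))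
    (Kf : Fin n → Set E3) (hKc : ∀ f, IsCompact (Kf f)) (hKv : ∀ f, Convex ℝ (Kf f))
    (hK0 : ∀ f, (0 : E3) ∈ Kf f) (hKs : ∀ f, -Kf f = Kf f)
    (Kf' : Fin n → Set E3) (hKc' : ∀ f, IsCompact (Kf' f)) (hKv' : ∀ f, Convex ℝ (Kf' f))
    (hK0' : ∀ f, (0 : E3) ∈ Kf' f) (hKs' : ∀ f, -Kf' f = Kf' f)
    (D : Set E3) (hDc : IsCompact D) (hDv : Convex ℝ D) (hD0 : (0 : E3) ∈ D) (hDs : -D = D)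
    {c : ℝ} (T : Finset (Fin n)) (hT : ∀ f, f ∉ T → Kf' f = Kf f)
    (hgap : ∀ f ∈ T, ∀ ν : E3, supportFn (Kf' f) ν ≤ supportFn (Kf f) ν + c * supportFn D ν) :
    (∑ f, (per (Kf' f) (G f) - ∑ g, (if f = g then 0 else
        (per (Kf' f) (G f) + per (Kf' f) (G g) - per (Kf' f) (G f ∪ G g)) / 2))) ≤
      (∑ f, (per (Kf f) (G f) - ∑ g, (if f = g then 0 else
        (per (Kf f) (G f) + per (Kf f) (G g) - per (Kf f) (G f ∪ G g)) / 2))) +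
      c * ∑ f ∈ T, (per D (G f) - ∑ g, (if f = g then 0 else
        (per D (G f) + per D (G g) - per D (G f ∪ G g)) / 2)) := by
  classical
  obtain ⟨k, H, ν, S, SX, -, hext, -⟩ := exists_exterior_crossSums G hPoly hvol hdisjG
  set X : Set E3 → Fin k → Fin k → ℝ := fun K a b =>
    (if a < b then (supportFn K (ν a b) + supportFn K (-ν a b)) *
        facetArea (closure (polytope (H a)) ∩ closure (polytope (H b))) (ν a b)
      else (supportFn K (ν b a) + supportFn K (-ν b a)) *
        facetArea (closure (polytope (H b)) ∩ closure (polytope (H a))) (ν b a)) with hX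
  -- each grain: free energy = half the cross sum with the exterior cells, for any admissible body
  have hf : ∀ (K : Set E3), IsCompact K → Convex ℝ K → (0 : E3) ∈ K → -K = K → ∀ f,
      per K (G f) - ∑ g, (if f = g then 0 else
        (per K (G f) + per K (G g) - per K (G f ∪ G g)) / 2) =
      (∑ a ∈ S f, ∑ b ∈ SX, X K a b) / 2 := by
    intro K hK hKv0 hK00 hKs0 f
    have h : 2 * per K (G f) = (∑ g ∈ Finset.univ.erase f,
        (per K (G f) + per K (G g) - per K (G f ∪ G g))) +
        ∑ a ∈ S f, ∑ b ∈ SX, X K a b := hext K hK hKv0 hK00 hKs0 f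
    rw [sum_ite_eq_sum_erase_div_two]
    linarith
  set FrK : Set E3 → Fin n → ℝ := fun K f => per K (G f) - ∑ g, (if f = g then 0 else
      (per K (G f) + per K (G g) - per K (G f ∪ G g)) / 2) with hFrK
  -- per-grain comparison
  have hgrain : ∀ f, FrK (Kf' f) f ≤ FrK (Kf f) f + (if f ∈ T then c * FrK D f else 0) := by
    intro f
    by_cases hfT : f ∈ T
    · rw [if_pos hfT]
      have hsum := crossSum_le_add_of_supportFn_le (hgap f hfT) H ν (S f) SX
      simp only [hFrK]
      rw [hf _ (hKc' f) (hKv' f) (hK0' f) (hKs' f) f, hf _ (hKc f) (hKv f) (hK0 f) (hKs f) f,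
        hf _ hDc hDv hD0 hDs f]
      simp only [hX] at hsum ⊢
      linarith
    · simp only [hFrK]
      rw [if_neg hfT, hT f hfT, add_zero]
  have hsum := Finset.sum_le_sum fun f (_ : f ∈ Finset.univ) => hgrain f
  rw [Finset.sum_add_distrib, ← Finset.sum_filter, Finset.filter_mem_eq_inter, Finset.univ_inter,
    ← Finset.mul_sum] at hsum
  exact hsum

end Summit.Ventures.Crystal3D.Theorems

end
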